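import Mathlib
import HarnessLib
import Summits.ResolutionOfSingularities.ResolutionOfSingularities.Theorems.RadicialJungCleanModelsLens5UnimodularRefinement3

/-!
# Positive unimodular refinement around an irrational ray (lens 5, part 4)

Port of `Cruxes/DescentPerfectToAll/Lens5_UnimodularRefinement.lean` (author: res-B-lens-5 g9/g10).
Part 4: The two-level reading of a rank-two weight — input `φ₁, φ₂` of `toric_lemma_classC`.

OURS · counted 0.  Nothing here proves resolution in characteristic `p`; no crux or stub is proved here.
Pure lattice combinatorics, Mathlib-only, def-free.

## Main results

- `fin3_other`: Given an index in `Fin 3`, there exists another.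
- `exists_two_level_reading`: THE TWO-LEVEL READING (class (C)) — integer functionals reading v-positivity lexicographically.

Resolution of singularities in positive characteristic is NOT proved.
-/

noncomputable section

set_option linter.dupNamespace false

namespace Summit.ResolutionOfSingularities.ResolutionOfSingularities.Theorems.RadicialJung.CleanModels.Lens5.UnimodularRefinement

/-! ## (rev 8) The TWO-LEVEL READING of a rank-two weight — the input `φ₁, φ₂` of `toric_lemma_classC`

The port has, in class (C): the monomial weight `φ : L →+ W` (`W` = the value group of `v`, written additively), the coarsening
`ψ : W →+ W₁` to the value group of the rank-one coarsening `v₁` (Mathlib `ValuationSubring.mapOfLE`, monotone), and from (htd)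
`rr Γ ≤ 2`: both `W₁ = Γ/Δ` and `Δ = ker ψ` have rational rank `≤ 1` (any two elements are `ℤ`-dependent); finally some parameter has
value outside `Δ` (else `v(M^×) ⊆ Δ`, impossible for a rank-two group of finite index).  From exactly these data the theorem produces
`φ₁, φ₂ : L →+ ℤ` with `0 < φ f ⟺ 0 < φ₁ f ∨ (φ₁ f = 0 ∧ 0 < φ₂ f)` and `φ f = 0 ⟺ φ₁ f = φ₂ f = 0` for ALL `f ∈ L` — so the hypotheses
and the conclusions of `toric_lemma_classC` translate to and from `v`-values of monomials.  Proof: the coarse weight `ψ ∘ φ` has a kernel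
of rank two, so (`exists_kernel_adapted_basis_of_rank_two_ker_pos`) one basis vector `e_{i₁}` carries it: `φ₁ :=` its coordinate; the
remainder `φ' := φ − φ₁ • φ(e_{i₁})` takes values in `Δ`, and either vanishes (`φ₂ := 0`) or again has a rank-two kernel, whence `φ₂`. -/

/-- Given one index in `Fin 3`, there is another. -/
lemma fin3_other (i₀ : Fin 3) : ∃ j : Fin 3, j ≠ i₀ := by
  revert i₀; decide

/-- **THE TWO-LEVEL READING** (class (C)): integer functionals `φ₁, φ₂` reading `v`-positivity of monomials lexicographically. -/
theorem exists_two_level_reading {L : Type} [AddCommGroup L] (b : Module.Basis (Fin 3) ℤ L)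
    {W W₁ : Type} [AddCommGroup W] [LinearOrder W] [IsOrderedAddMonoid W]
    [AddCommGroup W₁] [LinearOrder W₁] [IsOrderedAddMonoid W₁]
    (φ : L →+ W) (ψ : W →+ W₁) (hψ : Monotone ψ)
    (hW₁ : ∀ w w' : W₁, ∃ s t : ℤ, (s ≠ 0 ∨ t ≠ 0) ∧ s • w + t • w' = 0)
    (hΔ : ∀ w w' : W, ψ w = 0 → ψ w' = 0 → ∃ s t : ℤ, (s ≠ 0 ∨ t ≠ 0) ∧ s • w + t • w' = 0)
    (hne : ∃ x : L, ψ (φ x) ≠ 0) :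
    ∃ φ₁ φ₂ : L →+ ℤ, ∀ f : L,
      (0 < φ f ↔ 0 < φ₁ f ∨ (φ₁ f = 0 ∧ 0 < φ₂ f)) ∧ (φ f = 0 ↔ φ₁ f = 0 ∧ φ₂ f = 0) := by
  classical
  -- the coarse weight
  let χ : L →+ W₁ := ψ.comp φ
  have hχ : ∀ x, χ x = ψ (φ x) := fun _ => rfl
  -- Step 1: a basis vector of non-zero coarse weight, and two independent vectors of coarse weight zero
  obtain ⟨i₀, hi₀⟩ : ∃ i₀ : Fin 3, χ (b i₀) ≠ 0 := by
    by_contra hall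
    push Not at hall
    obtain ⟨x, hx⟩ := hne
    apply hx
    rw [← hχ, ← b.sum_repr x, map_sum]
    exact Finset.sum_eq_zero fun i _ => by rw [map_zsmul, hall i, smul_zero]
  obtain ⟨j, hj⟩ := fin3_other i₀
  obtain ⟨k, hkj, hk⟩ := fin3_third j i₀ hj
  have hkv : ∀ i : Fin 3, ∃ s t : ℤ, s ≠ 0 ∧ χ (s • b i + t • b i₀) = 0 := by
    intro i
    obtain ⟨s, t, hst, h⟩ := hW₁ (χ (b i)) (χ (b i₀))
    by_cases hs : s = 0
    · subst hs
      rw [zero_smul, zero_add] at h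
      rcases hst with h0 | h0
      · exact absurd rfl h0
      · exact absurd ((smul_eq_zero.mp h).resolve_left h0) hi₀
    · exact ⟨s, t, hs, by rw [map_add, map_zsmul, map_zsmul]; exact h⟩
  obtain ⟨s₁, t₁, hs₁, hx⟩ := hkv j
  obtain ⟨s₂, t₂, hs₂, hy⟩ := hkv k
  have hind : ∀ s t : ℤ, s • (s₁ • b j + t₁ • b i₀) + t • (s₂ • b k + t₂ • b i₀) = 0 → s = 0 ∧ t = 0 := by
    intro s t hst
    have hcj := congrArg (fun z => b.repr z j) hst
    have hck := congrArg (fun z => b.repr z k) hst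
    simp only [map_add, map_zsmul, map_zero, Finsupp.coe_add, Finsupp.coe_smul, Pi.add_apply, Pi.smul_apply,
      Module.Basis.repr_self, Finsupp.single_apply, Finsupp.coe_zero, Pi.zero_apply, smul_eq_mul,
      Ne.symm hj, hkj, Ne.symm hk, Ne.symm hkj, if_true, if_false] at hcj hck
    constructor
    · have h1 : s * s₁ = 0 := by rw [← hcj]; ring
      exact (mul_eq_zero.mp h1).resolve_right hs₁
    · have h1 : t * s₂ = 0 := by rw [← hck]; ring
      exact (mul_eq_zero.mp h1).resolve_right hs₂
  -- Step 2: the coarse weight is carried by one basis vector `e i₁`; `φ₁ :=` its coordinate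
  obtain ⟨e, i₁, hpos₁, -, hrepr₁, -⟩ :=
    exists_kernel_adapted_basis_of_rank_two_ker_pos b χ ⟨b i₀, hi₀⟩
      ⟨s₁ • b j + t₁ • b i₀, s₂ • b k + t₂ • b i₀, hx, hy, hind⟩
  let φ₁ : L →+ ℤ :=
    { toFun := fun f => e.repr f i₁
      map_zero' := by simp
      map_add' := fun f g => by simp }
  have hφ₁ : ∀ f, φ₁ f = e.repr f i₁ := fun _ => rfl
  have hw₁ψ : 0 < ψ (φ (e i₁)) := by simpa only [hχ] using hpos₁
  have hw₁ : 0 < φ (e i₁) := by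
    by_contra hle
    push Not at hle
    have h := hψ hle
    rw [map_zero] at h
    exact absurd hw₁ψ (not_lt.mpr h)
  -- Step 3: the fine part `φ' := φ - φ₁ • φ (e i₁)` takes values in `ker ψ`
  let φ' : L →+ W :=
    { toFun := fun f => φ f - e.repr f i₁ • φ (e i₁)
      map_zero' := by simp
      map_add' := fun f g => by
        simp only [map_add, Finsupp.coe_add, Pi.add_apply, add_smul]
        abel }
  have hφ' : ∀ f, φ' f = φ f - e.repr f i₁ • φ (e i₁) := fun _ => rfl
  have hφ'ψ : ∀ f, ψ (φ' f) = 0 := by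
    intro f
    rw [hφ', map_sub, map_zsmul]
    have h := hrepr₁ f
    simp only [hχ] at h
    rw [h, sub_self]
  have hdecomp : ∀ f, φ f = e.repr f i₁ • φ (e i₁) + φ' f := fun f => by rw [hφ']; abel
  have hφ'e : φ' (e i₁) = 0 := by
    rw [hφ', Module.Basis.repr_self, Finsupp.single_eq_same, one_smul, sub_self]
  by_cases hzero : ∀ i, φ' (e i) = 0
  · -- one level only: `φ = φ₁ • w₁`
    have hφ'0 : ∀ f, φ' f = 0 := by
      intro f
      rw [← e.sum_repr f, map_sum]
      exact Finset.sum_eq_zero fun i _ => by rw [map_zsmul, hzero i, smul_zero]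
    refine ⟨φ₁, 0, fun f => ⟨?_, ?_⟩⟩
    · rw [hdecomp f, hφ'0 f, add_zero, AddMonoidHom.zero_apply, hφ₁]
      constructor
      · intro h
        left
        by_contra hle
        push Not at hle
        exact absurd h (not_lt.mpr (smul_nonpos_of_nonpos_of_nonneg hle hw₁.le))
      · rintro (h | ⟨_, h⟩)
        · exact smul_pos h hw₁
        · exact absurd h (lt_irrefl _)
    · rw [hdecomp f, hφ'0 f, add_zero, AddMonoidHom.zero_apply, hφ₁]
      constructor
      · intro h
        exact ⟨(smul_eq_zero.mp h).resolve_right hw₁.ne', rfl⟩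
      · rintro ⟨h, -⟩
        rw [h, zero_smul]
  · -- second level: `φ'` is carried by one vector of a further adapted basis
    push Not at hzero
    obtain ⟨i₂, hi₂⟩ := hzero
    obtain ⟨j', hj'⟩ := fin3_other i₁
    obtain ⟨k', hk'j', hk'⟩ := fin3_third j' i₁ hj'
    obtain ⟨s, t, hst, hrel⟩ := hΔ (φ' (e j')) (φ' (e k')) (hφ'ψ (e j')) (hφ'ψ (e k'))
    have hyk : φ' (s • e j' + t • e k') = 0 := by rw [map_add, map_zsmul, map_zsmul]; exact hrel
    have hind' : ∀ σ τ : ℤ, σ • e i₁ + τ • (s • e j' + t • e k') = 0 → σ = 0 ∧ τ = 0 := by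
      intro σ τ h
      have hc1 := congrArg (fun z => e.repr z i₁) h
      have hcj := congrArg (fun z => e.repr z j') h
      have hck := congrArg (fun z => e.repr z k') h
      simp only [map_add, map_zsmul, map_zero, Finsupp.coe_add, Finsupp.coe_smul, Pi.add_apply, Pi.smul_apply,
        Module.Basis.repr_self, Finsupp.single_apply, Finsupp.coe_zero, Pi.zero_apply, smul_eq_mul,
        Ne.symm hj', hk', Ne.symm hk', hj', hk'j', Ne.symm hk'j', if_true, if_false] at hc1 hcj hck
      have hσ : σ = 0 := by rw [← hc1]; ring
      have hτs : τ * s = 0 := by rw [← hcj]; ring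
      have hτt : τ * t = 0 := by rw [← hck]; ring
      refine ⟨hσ, ?_⟩
      rcases hst with hs | ht
      · exact (mul_eq_zero.mp hτs).resolve_right hs
      · exact (mul_eq_zero.mp hτt).resolve_right ht
    obtain ⟨e', i₃, hpos₂, -, hrepr₂, -⟩ :=
      exists_kernel_adapted_basis_of_rank_two_ker_pos b φ' ⟨e i₂, hi₂⟩
        ⟨e i₁, s • e j' + t • e k', hφ'e, hyk, hind'⟩
    let φ₂ : L →+ ℤ :=
      { toFun := fun f => e'.repr f i₃
        map_zero' := by simp
        map_add' := fun f g => by simp }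
    have hφ₂ : ∀ f, φ₂ f = e'.repr f i₃ := fun _ => rfl
    have hw₂ : 0 < φ' (e' i₃) := hpos₂
    have hw₂ψ : ψ (φ' (e' i₃)) = 0 := hφ'ψ _
    have hf : ∀ f, φ f = e.repr f i₁ • φ (e i₁) + e'.repr f i₃ • φ' (e' i₃) := fun f => by
      rw [hdecomp f, hrepr₂ f]
    have hψf : ∀ f, ψ (φ f) = e.repr f i₁ • ψ (φ (e i₁)) := fun f => by
      rw [hf f, map_add, map_zsmul, map_zsmul, hw₂ψ, smul_zero, add_zero]
    refine ⟨φ₁, φ₂, fun f => ⟨?_, ?_⟩⟩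
    · rw [hφ₁, hφ₂]
      constructor
      · intro hpos
        have h0 : 0 ≤ ψ (φ f) := by simpa using hψ hpos.le
        rw [hψf f] at h0
        have hn : 0 ≤ e.repr f i₁ := by
          by_contra hlt
          push Not at hlt
          exact absurd h0 (not_le.mpr (smul_neg_of_neg_of_pos hlt hw₁ψ))
        rcases hn.lt_or_eq with hn | hn
        · exact Or.inl hn
        · right
          refine ⟨hn.symm, ?_⟩
          rw [hf f, ← hn, zero_smul, zero_add] at hpos
          by_contra hle
          push Not at hle
          exact absurd hpos (not_lt.mpr (smul_nonpos_of_nonpos_of_nonneg hle hw₂.le))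
      · rintro (hn | ⟨hn, hm⟩)
        · by_contra hle
          push Not at hle
          have h1 : ψ (φ f) ≤ 0 := by simpa using hψ hle
          rw [hψf f] at h1
          exact absurd (smul_pos hn hw₁ψ) (not_lt.mpr h1)
        · rw [hf f, hn, zero_smul, zero_add]
          exact smul_pos hm hw₂
    · rw [hφ₁, hφ₂]
      constructor
      · intro h0
        have h1 : ψ (φ f) = 0 := by rw [h0, map_zero]
        rw [hψf f] at h1
        have hn : e.repr f i₁ = 0 := (smul_eq_zero.mp h1).resolve_right hw₁ψ.ne'
        refine ⟨hn, ?_⟩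
        rw [hf f, hn, zero_smul, zero_add] at h0
        exact (smul_eq_zero.mp h0).resolve_right hw₂.ne'
      · rintro ⟨hn, hm⟩
        rw [hf f, hn, hm, zero_smul, zero_smul, add_zero]

end Summit.ResolutionOfSingularities.ResolutionOfSingularities.Theorems.RadicialJung.CleanModels.Lens5.UnimodularRefinement

end
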